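/-
Soloist `solo-ValiantsHypothesis-informed`, session 4 — Reed–Solomon private-point designs.
-/
import Mathlib
import Summits.ValiantsHypothesis.ValiantsHypothesis.Theorems.SoloInformedQuadSpanReduction

/-!
# Reed–Solomon designs: `SoloDesign K h m n` is inhabited for `m ≤ q^k`, `q² ≤ n`

Companion to `SoloInformedQuadSpanReduction.lean` (soloist note `paper/quadspan.md`, Thm 2.8 (a)):
the hypotheses `S : ∀ n, SoloDesign K h (m n) n` of `soloInformed_vp_ne_vnp_of_quadSpanBound(_cor58)`
are not vacuous.  For a prime `q`, the graphs `S_c = {(a, p_c(a)) : a ∈ 𝔽_q} ⊂ 𝔽_q × 𝔽_q` of the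
`q^k` polynomials `p_c = ∑_{t<k} c_t X^t` pairwise meet in `≤ k - 1` points, so in any subfamily of
`≤ K` graphs every member keeps a private point as soon as `(K-1)(k-1) < q`
(`solo_rs_privatePoints`); private points give `(K, h)`-sign-independence for every `h`
(`SoloDesign.ofPrivatePoints`), and the property transfers along injections of the index set and of
the ground set (`solo_pp_transfer`).  Main statement: `soloInformed_nonempty_design` —
`q` prime, `(K-1)(k-1) < q`, `m ≤ q^k`, `q*q ≤ n` ⟹ `Nonempty (SoloDesign K h m n)`.

References: standard (Reed–Solomon / polynomial-evaluation designs, e.g. Nisan–Wigderson designs);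
R. Raz, Theory of Computing 6 (2010), §5 for the role of the design size.
-/

noncomputable section

open Finset Polynomial

namespace Summit.ValiantsHypothesis.ValiantsHypothesis.Theorems

/-! ### The polynomials `p_c` -/

/-- The polynomial with coefficient vector `c : Fin k → R`: `p_c = ∑_{t<k} c_t X^t`. -/
def soloRSPoly {R : Type*} [CommRing R] {k : ℕ} (c : Fin k → R) : R[X] :=
  ∑ t : Fin k, C (c t) * X ^ (t : ℕ)

section RSPoly

variable {R : Type*} [CommRing R] {k : ℕ}

/-- `deg p_c < k`. -/
theorem soloRSPoly_degree_lt (c : Fin k → R) : (soloRSPoly c).degree < k :=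
  Polynomial.degree_sum_fin_lt c

/-- The `t`-th coefficient of `p_c` is `c t`. -/
theorem soloRSPoly_coeff (c : Fin k → R) (t : Fin k) : (soloRSPoly c).coeff t = c t := by
  simp only [soloRSPoly, finsetSum_coeff, coeff_C_mul_X_pow]
  rw [Finset.sum_eq_single t]
  · simp
  · intro b _ hb
    simp [Fin.val_inj, Ne.symm hb]
  · intro ht; exact absurd (Finset.mem_univ t) ht

/-- `c ↦ p_c` is additive: `p_c - p_{c'} = p_{c - c'}`. -/
theorem soloRSPoly_sub (c c' : Fin k → R) :
    soloRSPoly c - soloRSPoly c' = soloRSPoly (c - c') := by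
  simp only [soloRSPoly, Pi.sub_apply, C_sub, sub_mul, Finset.sum_sub_distrib]

/-- `p_c ≠ 0` for `c ≠ 0`. -/
theorem soloRSPoly_ne_zero {c : Fin k → R} (hc : c ≠ 0) : soloRSPoly c ≠ 0 := by
  obtain ⟨t, ht⟩ := Function.ne_iff.mp hc
  intro h0
  apply ht
  have := soloRSPoly_coeff c t
  rw [h0, coeff_zero] at this
  simpa using this.symm

/-- Over a domain, a nonzero `p_d` (`d ≠ 0`) has at most `k - 1` zeros. -/
theorem solo_card_zeros_le [IsDomain R] [Fintype R] [DecidableEq R] {d : Fin k → R} (hd : d ≠ 0) :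
    (univ.filter fun a => (soloRSPoly d).eval a = 0).card ≤ k - 1 := by
  have hp : soloRSPoly d ≠ 0 := soloRSPoly_ne_zero hd
  have hnat : (soloRSPoly d).natDegree < k :=
    (natDegree_lt_iff_degree_lt hp).mpr (soloRSPoly_degree_lt d)
  have hsub : (univ.filter fun a => (soloRSPoly d).eval a = 0) ⊆ (soloRSPoly d).roots.toFinset := by
    intro a ha
    rw [Finset.mem_filter] at ha
    rw [Multiset.mem_toFinset, mem_roots hp]
    exact ha.2
  calc (univ.filter fun a => (soloRSPoly d).eval a = 0).card
      ≤ (soloRSPoly d).roots.toFinset.card := Finset.card_le_card hsub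
    _ ≤ Multiset.card (soloRSPoly d).roots := Multiset.toFinset_card_le _
    _ ≤ (soloRSPoly d).natDegree := card_roots' _
    _ ≤ k - 1 := by omega

end RSPoly

/-! ### Graphs of the `p_c` over `𝔽_q` and their private points -/

/-- The graph `S_c = {(a, p_c(a)) : a ∈ 𝔽_q}` of `p_c` over `ZMod q`. -/
def soloRSSet {q k : ℕ} [NeZero q] (c : Fin k → ZMod q) : Finset (ZMod q × ZMod q) :=
  univ.image fun a => (a, (soloRSPoly c).eval a)

/-- **Private points of Reed–Solomon graph families.** If `q` is prime and `(K-1)(k-1) < q`, then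
in every family of at most `K` graphs `S_c` each member has a point on no other member. -/
theorem solo_rs_privatePoints (q k K : ℕ) [Fact q.Prime] (hKq : (K - 1) * (k - 1) < q) :
    ∀ T : Finset (Fin k → ZMod q), T.card ≤ K → ∀ i ∈ T,
      ∃ x ∈ soloRSSet i, ∀ j ∈ T, j ≠ i → x ∉ soloRSSet j := by
  classical
  intro T hT i hi
  -- the bad abscissae: where `p_i` agrees with some other `p_j`, `j ∈ T`
  set B : Finset (ZMod q) :=
    (T.erase i).biUnion fun j => univ.filter fun a => (soloRSPoly (i - j)).eval a = 0 with hB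
  have hBcard : B.card < (univ : Finset (ZMod q)).card := by
    have h1 : B.card ≤ (T.erase i).card * (k - 1) := by
      calc B.card ≤ ∑ j ∈ T.erase i, (univ.filter fun a => (soloRSPoly (i - j)).eval a = 0).card :=
            Finset.card_biUnion_le
        _ ≤ ∑ _j ∈ T.erase i, (k - 1) := by
            apply Finset.sum_le_sum
            intro j hj
            have hji : j ≠ i := (Finset.mem_erase.mp hj).1
            exact solo_card_zeros_le (sub_ne_zero.mpr (Ne.symm hji))
        _ = (T.erase i).card * (k - 1) := by simp
    have h2 : (T.erase i).card * (k - 1) ≤ (K - 1) * (k - 1) := by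
      apply Nat.mul_le_mul_right
      rw [Finset.card_erase_of_mem hi]
      omega
    rw [Finset.card_univ, ZMod.card]
    omega
  obtain ⟨a, -, ha⟩ := Finset.exists_mem_notMem_of_card_lt_card hBcard
  refine ⟨(a, (soloRSPoly i).eval a), ?_, ?_⟩
  · exact Finset.mem_image.mpr ⟨a, Finset.mem_univ a, rfl⟩
  · intro j hj hji hmem
    obtain ⟨a', -, ha'⟩ := Finset.mem_image.mp hmem
    simp only [Prod.mk.injEq] at ha'
    obtain ⟨rfl, heval⟩ := ha'
    apply ha
    rw [hB, Finset.mem_biUnion]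
    refine ⟨j, Finset.mem_erase.mpr ⟨hji, hj⟩, ?_⟩
    rw [Finset.mem_filter]
    refine ⟨Finset.mem_univ _, ?_⟩
    rw [← soloRSPoly_sub, eval_sub, heval, sub_self]

/-! ### Transfer along injections and the design -/

/-- Private points survive reindexing along an injection of the index set and pushing the members
forward along an injection of the ground set. -/
theorem solo_pp_transfer {α β : Type*} [DecidableEq β] {K m n : ℕ}
    (S : α → Finset β) (eι : Fin m ↪ α) (eg : β ↪ Fin n)
    (hS : ∀ T : Finset α, T.card ≤ K → ∀ i ∈ T, ∃ x ∈ S i, ∀ j ∈ T, j ≠ i → x ∉ S j) :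
    ∀ T : Finset (Fin m), T.card ≤ K → ∀ i ∈ T,
      ∃ x ∈ (S (eι i)).map eg, ∀ j ∈ T, j ≠ i → x ∉ (S (eι j)).map eg := by
  intro T hT i hi
  obtain ⟨x, hx, hpriv⟩ :=
    hS (T.map eι) (by simpa using hT) (eι i) (Finset.mem_map_of_mem _ hi)
  refine ⟨eg x, Finset.mem_map_of_mem _ hx, ?_⟩
  intro j hj hji hmem
  rw [Finset.mem_map'] at hmem
  exact hpriv (eι j) (Finset.mem_map_of_mem _ hj) (fun h => hji (eι.injective h)) hmem

/-- **Reed–Solomon designs exist.** For a prime `q` with `(K-1)(k-1) < q`, every `m ≤ q^k` and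
`n ≥ q²`: there is a `(K, h)`-sign-independent family of `m` subsets of `Fin n` (for every `h`). -/
theorem soloInformed_nonempty_design (K h k q m n : ℕ) (hq : q.Prime) (hKq : (K - 1) * (k - 1) < q)
    (hm : m ≤ q ^ k) (hn : q * q ≤ n) : Nonempty (SoloDesign K h m n) := by
  classical
  haveI : Fact q.Prime := ⟨hq⟩
  have hcardι : Fintype.card (Fin k → ZMod q) = q ^ k := by
    simp [ZMod.card]
  have hcardg : Fintype.card (ZMod q × ZMod q) = q * q := by
    simp [Fintype.card_prod, ZMod.card]
  let eι : Fin m ↪ (Fin k → ZMod q) :=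
    (Fin.castLEEmb hm).trans (Fintype.equivFinOfCardEq hcardι).symm.toEmbedding
  let eg : ZMod q × ZMod q ↪ Fin n :=
    (Fintype.equivFinOfCardEq hcardg).toEmbedding.trans (Fin.castLEEmb hn)
  exact ⟨SoloDesign.ofPrivatePoints (fun i => (soloRSSet (eι i)).map eg)
    (solo_pp_transfer soloRSSet eι eg (solo_rs_privatePoints q k K hKq))⟩

/-- The sizes used in the note (Thm 2.8 (a)): with `k ≥ 1` and `K ≥ 1` the condition reads
`(K-1)(k-1) < q`, and `m = q^k ≥ (n/4)^{k/2}` designs on `n` points exist whenever a prime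
`q ∈ (√n/2, √n]` is chosen; in particular, for every `K h k` and every prime `q > (K-1)(k-1)`,
`SoloDesign K h (q^k) (q*q)` is inhabited. -/
theorem soloInformed_nonempty_design_sq (K h k q : ℕ) (hq : q.Prime) (hKq : (K - 1) * (k - 1) < q) :
    Nonempty (SoloDesign K h (q ^ k) (q * q)) :=
  soloInformed_nonempty_design K h k q (q ^ k) (q * q) hq hKq le_rfl le_rfl

end Summit.ValiantsHypothesis.ValiantsHypothesis.Theorems
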